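import Mathlib
import Summits.NavierStokesRegularity.NavierStokesRegularity.Theorems.TaoLadderRungTwoBreakBlowupRigidityOneViscousFrontExtraction
import HarnessLib

/-!
# The REGISTERED STUB `stub_eternalFromBlowup` of K2(1) `TaoLadderRungTwoBreak.BlowupRigidityOne`
  (stmt-NavierStokesRegularity-20206) modulo a VISCOUS strictly-surviving clocked front — `a = 1` corollaries of
  `eternal_surviving_of_viscousClockedFront`

MODEL lattice ODEs only (Tao 2016 §4 (4.8), the viscous equation before Thm. 4.2, §6.4); nothing here is a statement about
the Navier–Stokes equations; NO item is closed (`--supports stmt-NavierStokesRegularity-20206`). `m = 4` in the stub-shaped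
corollary, general `m` otherwise.

* `eternal_surviving_one_of_viscousClockedFront` — `a = 1`: under the STRICT (S₁) clause `(1+ε₀)⁻¹ < ν_r²` the thresholds
  `Λ²ν_r² > 1`, `1 ≤ physWeight 1 ε₀·Λ²ν_r²`, `(1+ε₀)² < Λν_r` are automatic;
* `stub_eternalFromBlowup_of_viscousClockedFronts` — the registered stub signature VERBATIM from the viscous front bundle
  attached to every robust blow-up below threshold (`ν = 0` recovers `stub_eternalFromBlowup_of_clockedFronts`).

HONEST LABEL: conditional; the viscous front bundle («some viscous companion of a robust blow-up of a fixed-spread table is a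
clocked front reaching every shell with energy fraction `ν_r^{2k}`, `ν_r² > (1+ε₀)^{-1}`, with bounded per-shell action») is
OPEN; `stub_eternalIsDSS` untouched; no stub, crux or summit is proved here.
-/

noncomputable section

-- the summit and its single sub-problem share the name (CONVENTIONS §1)
set_option linter.dupNamespace false

open Set Filter Topology MeasureTheory

namespace Summit.NavierStokesRegularity.NavierStokesRegularity.Theorems

namespace BlowupRigidityOne

open Literature.Analysis.FluidPDE Literature.Analysis.FluidPDE.TaoCascade
open Summit.NavierStokesRegularity.NavierStokesRegularity.Cruxes.MinimalBlowupExtraction.Extraction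
  (exists_subseq_continuousLimit)
open Summit.NavierStokesRegularity.NavierStokesRegularity.Cruxes.MinimalBlowupExtraction.TableCont
  (tendsto_tableQ_comp tendsto_tableA_comp tendsto_tableB_comp)
open TransitMassLedgerEnergy (continuous_tableQ continuous_tableA continuous_tableB_comp)

variable {m : ℕ}

/-- **The case `a = 1`** of the viscous extraction: under the STRICT (S₁) clause `(1+ε₀)⁻¹ < ν_r²` the thresholds
`Λ²ν_r² > 1`, `1 ≤ physWeight 1 ε₀ · Λ²ν_r²` and the strictness `(1+ε₀)² < Λν_r` (equivalently `ν_r² > (1+ε₀)^{-1}`,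
since `Λ² = (1+ε₀)^5`) are automatic: a `ν`-viscous clocked front at a strictly surviving ratio has an admissible
INVISCID eternal ω-limit that is (S₁)-surviving forward — literally the conclusion
`∃ W, IsEternal ε₀ α W ∧ EternalSurvivingFwd 1 ε₀ W` of the registered stub `stub_eternalFromBlowup`.
(At the critical ratio `ν_r² = (1+ε₀)^{-1}` the covariant viscosity does not die and the limit is an `IsEternalVisc`
solution — the object of K2ᵛ ⟨20420⟩, not of this stub.)
[cite: Tao2016AveragedNS, §4 (4.8) and the viscous equation before Thm. 4.2, §6.4; KochNadirashviliSereginSverak2009, Thm 1.1 ff.; cell vocabulary] -/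
theorem eternal_surviving_one_of_viscousClockedFront {ε₀ ν T A B νr cf κ₁ κ₂ : ℝ} (hε : 0 < ε₀) (hT : 0 < T)
    (hνv : 0 ≤ ν)
    {α : Fin m → Fin m → Fin m → ℤ × ℤ × ℤ → ℝ}
    {X : Fin m → ℤ → ℝ → ℝ} (hC1 : ∀ i n, ContDiffOn ℝ 1 (X i n) (Set.Ico 0 T))
    (hmot : ∀ i n t, 0 ≤ t → t < T → derivWithin (X i n) (Set.Ici 0) t =
      quadTerm ε₀ α X i n t - ν * (1 + ε₀) ^ ((2 : ℝ) * n) * X i n t)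
    (hact : ∀ k : ℤ, IntegrableOn (fun t => ‖shellVec X k t‖) (Ico 0 T) ∧
      bigLam ε₀ ^ k * (∫ t in Ico 0 T, ‖shellVec X k t‖) ≤ A)
    (hν : 0 < νr) (hν1 : (1 + ε₀)⁻¹ < νr ^ 2)
    (hamp : ∀ (j : ℤ) (t : ℝ), 0 ≤ t → t < T → ‖shellVec X j t‖ ≤ B * νr ^ j)
    {τ : ℕ → ℝ} (hτ : ∀ k : ℕ, 0 ≤ τ k ∧ τ k < T)
    (hfloor : ∀ k : ℕ, cf * (νr ^ 2) ^ k ≤ ‖shellVec X (k : ℤ) (τ k)‖ ^ 2)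
    (hclock₁ : ∀ k : ℕ, κ₁ ≤ (bigLam ε₀ ^ 2 * νr ^ 2) ^ k * (T - τ k) ^ 2)
    (hclock₂ : ∀ k : ℕ, (bigLam ε₀ ^ 2 * νr ^ 2) ^ k * (T - τ k) ^ 2 ≤ κ₂)
    (hcf : 0 < cf) (hκ₁ : 0 < κ₁) (hκ₂ : 0 < κ₂) :
    ∃ Wlim : ℤ → ℝ → Em m, IsEternal ε₀ α Wlim ∧ EternalSurvivingFwd 1 ε₀ Wlim := by
  have hb : (0 : ℝ) < 1 + ε₀ := by linarith
  have hΛ : 0 < bigLam ε₀ := bigLam_pos (by linarith)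
  have hpw : 1 ≤ physWeight 1 ε₀ * (bigLam ε₀ ^ 2 * νr ^ 2) :=
    physWeight_mul_ge_one_of_surviving hε (a := 1) (by rw [Real.rpow_neg_one]; exact hν1.le)
  have h5 : (1 + ε₀) ^ 4 < (1 + ε₀) ^ 5 * νr ^ 2 := by
    calc (1 + ε₀) ^ 4 = (1 + ε₀) ^ 5 * (1 + ε₀)⁻¹ := by field_simp
      _ < (1 + ε₀) ^ 5 * νr ^ 2 := mul_lt_mul_of_pos_left hν1 (pow_pos hb 5)
  have hq1 : 1 < bigLam ε₀ ^ 2 * νr ^ 2 := by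
    rw [bigLam_sq hε]
    exact lt_of_lt_of_le (one_lt_pow₀ (by linarith : (1 : ℝ) < 1 + ε₀) (by norm_num)) h5.le
  have hstrict : (1 + ε₀) ^ 2 < bigLam ε₀ * νr := by
    have h2 : ((1 + ε₀) ^ 2) ^ 2 < (bigLam ε₀ * νr) ^ 2 := by
      rw [mul_pow, bigLam_sq hε, ← pow_mul]
      exact h5
    exact lt_of_pow_lt_pow_left₀ 2 (mul_pos hΛ hν).le h2
  set W : ℤ → ℝ → Em m := fun n σ => (bigLam ε₀ ^ n * Real.exp (-σ)) • shellVec X n (T - Real.exp (-σ)) with hW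
  exact eternal_surviving_of_viscousClockedFront hε hT hνv hC1 hmot (W := W) (fun n σ => rfl) hact hν hamp hτ hfloor
    hclock₁ hclock₂ hcf hκ₁ hκ₂ hq1 hpw hstrict

/-- **THE REGISTERED STUB `stub_eternalFromBlowup` MODULO THE VISCOUS FRONT BUNDLE.** If below a threshold every robust
blow-up (`NoGlobalCascade ε₀ α X₀`) of a table `α ∈ E₂(R)` admits SOME `ν`-viscous flow of `α` (`ν ≥ 0`; `ν = 0` is the
exact flow of `stub_eternalFromBlowup_of_clockedFronts`) on some `[0,T)` with a per-shell ACTION CEILING, an AMPLITUDE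
CEILING `B ν_r^j` at a STRICTLY (S₁)-surviving ratio `(1+ε₀)⁻¹ < ν_r²`, and CLOCKED FIRING (floor `c_f (ν_r²)^k` at times
`τ_k ∈ [0,T)` with `κ₁ ≤ (Λ²ν_r²)^k (T-τ_k)² ≤ κ₂`, all `k ∈ ℕ`), then the signature of `stub_eternalFromBlowup`
(skeleton `9d85f4d387c689cd` of item 20206) holds verbatim. This is the form in which robustness can be fed in: it
constrains the viscous companions of the datum at a fixed budget (`companion_neverQuiet_of_noGlobalCascade`), not the
exact flow. HONEST LABEL: the viscous front bundle is OPEN; nothing is closed here.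
[cite: Tao2016AveragedNS, §4 Thm. 4.2 (statement shape), (4.8), the viscous equation before Thm. 4.2, §6.4; KochNadirashviliSereginSverak2009, Thm 1.1 ff.; cell vocabulary (`NoGlobalCascade`, `IsEternal`, `EternalSurvivingFwd`)] -/
theorem stub_eternalFromBlowup_of_viscousClockedFronts
    (H : ∀ R : ℝ, 1 ≤ R → ∃ εs : ℝ, 0 < εs ∧ ∀ ε₀ : ℝ, 0 < ε₀ → ε₀ ≤ εs →
      ∀ (α : (Fin 4 → Fin 4 → Fin 4 → ℤ × ℤ × ℤ → ℝ)) (X₀ : Fin 4 → ℝ),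
        InTableClass R α → NoGlobalCascade ε₀ α X₀ →
        ∃ (ν T A B νr cf κ₁ κ₂ : ℝ) (X : Fin 4 → ℤ → ℝ → ℝ) (τ : ℕ → ℝ), 0 ≤ ν ∧ 0 < T ∧
          (∀ i n, ContDiffOn ℝ 1 (X i n) (Set.Ico 0 T)) ∧
          (∀ i n t, 0 ≤ t → t < T → derivWithin (X i n) (Set.Ici 0) t =
            quadTerm ε₀ α X i n t - ν * (1 + ε₀) ^ ((2 : ℝ) * n) * X i n t) ∧
          (∀ k : ℤ, IntegrableOn (fun t => ‖shellVec X k t‖) (Ico 0 T) ∧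
            bigLam ε₀ ^ k * (∫ t in Ico 0 T, ‖shellVec X k t‖) ≤ A) ∧
          0 < νr ∧ (1 + ε₀)⁻¹ < νr ^ 2 ∧
          (∀ (j : ℤ) (t : ℝ), 0 ≤ t → t < T → ‖shellVec X j t‖ ≤ B * νr ^ j) ∧
          (∀ k : ℕ, 0 ≤ τ k ∧ τ k < T) ∧
          (∀ k : ℕ, cf * (νr ^ 2) ^ k ≤ ‖shellVec X (k : ℤ) (τ k)‖ ^ 2) ∧
          (∀ k : ℕ, κ₁ ≤ (bigLam ε₀ ^ 2 * νr ^ 2) ^ k * (T - τ k) ^ 2) ∧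
          (∀ k : ℕ, (bigLam ε₀ ^ 2 * νr ^ 2) ^ k * (T - τ k) ^ 2 ≤ κ₂) ∧
          0 < cf ∧ 0 < κ₁ ∧ 0 < κ₂) :
    ∀ R : ℝ, 1 ≤ R → ∃ εs : ℝ, 0 < εs ∧ ∀ ε₀ : ℝ, 0 < ε₀ → ε₀ ≤ εs →
      ∀ (α : (Fin 4 → Fin 4 → Fin 4 → ℤ × ℤ × ℤ → ℝ)) (X₀ : Fin 4 → ℝ),
        Literature.Analysis.FluidPDE.TaoCascade.InTableClass R α →
        Literature.Analysis.FluidPDE.TaoCascade.NoGlobalCascade ε₀ α X₀ →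
        ∃ W : ℤ → ℝ → Literature.Analysis.FluidPDE.TaoCascade.Em 4,
          Literature.Analysis.FluidPDE.TaoCascade.IsEternal ε₀ α W ∧
          Literature.Analysis.FluidPDE.TaoCascade.EternalSurvivingFwd 1 ε₀ W := by
  intro R hR
  obtain ⟨εs, hεs, hH⟩ := H R hR
  refine ⟨εs, hεs, fun ε₀ hε hεle α X₀ hα hNG => ?_⟩
  obtain ⟨ν, T, A, B, νr, cf, κ₁, κ₂, X, τ, hνv, hT, hC1, hmot, hact, hν, hν1, hamp, hτ, hfloor, hclock₁, hclock₂,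
    hcf, hκ₁, hκ₂⟩ := hH ε₀ hε hεle α X₀ hα hNG
  exact eternal_surviving_one_of_viscousClockedFront hε hT hνv hC1 hmot hact hν hν1 hamp hτ hfloor hclock₁ hclock₂
    hcf hκ₁ hκ₂


end BlowupRigidityOne

end Summit.NavierStokesRegularity.NavierStokesRegularity.Theorems

end
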